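import Summits.MatrixMultiplication.MatrixMultiplication.Theses.LevelGradedCohnUmans

/-!
# `SnLevelDesigns` (crux stmt-MatrixMultiplication-7613), line `garnir-annihilator`, stub S6 `stub_garnirDesigns`:
# the COLLISION LADDER (negative-side support, refuter drefute gen 3)

Sorry-free; nothing here asserts a route item positively.  Context (`Cruxes/SnLevelDesigns/NegativeNotes-garnir-
annihilator-drefute-g3.md` §3): S6 forces sets `X, Z ⊆ 𝔖ₙ` with `X⁻¹Z` inside the Schensted shell
`B_k = {lis ≥ n - k}` and `(x,z) ↦ x⁻¹z` injective.  The lemmas below are the rigorous core of the obstruction: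

* `strictMonoOn_inv_mul` (Lemma L, monotone composition) — if `x` is increasing on the position set `S` and `z` on
  `T`, then `x⁻¹ * z` is increasing on `{p ∈ T : z p ∈ x(S)}`;
* `card_filter_mem_image` — that set has `|x(S) ∩ z(T)|` elements;
* `exists_incSubseq_inv_mul`, `exists_incSubseq_inv_mul_compl` — hence `x⁻¹ z` has an increasing subsequence of
  length `|x(S) ∩ z(T)| = n - |x(S)ᶜ ∪ z(T)ᶜ|`: two permutations at Ulam distance `a`, `b` from the identity that share
  `r` displaced letters have a product in `B_{a+b-r}`, not merely in `B_{a+b}` ("letters erase additively");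
* `card_filter_shared_le` — the COUNTING FORM (★): if `(x,z) ↦ x⁻¹z` is injective on `X ×ˢ Z`, then for every `j` the
  pairs whose displaced-letter sets have union of size `≤ j` are at most as many as the elements of `B_j`, stated with
  `B_j` in the crux's own vocabulary `{g | ∃ s, n - j ≤ s.card ∧ StrictMonoOn g s}`.
-/

set_option linter.dupNamespace false

namespace Summit.MatrixMultiplication.MatrixMultiplication.Theorems.SnLevelDesigns.Negative

open scoped BigOperators

/-- **Lemma L (monotone composition).** If `x` is strictly increasing on the positions `S` and `z` on the positions
`T`, then `x⁻¹ * z` is strictly increasing on the positions `p ∈ T` whose `z`-letter is one of the letters `x` keeps in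
increasing order. -/
theorem strictMonoOn_inv_mul {n : ℕ} (x z : Equiv.Perm (Fin n)) {S T : Finset (Fin n)}
    (hx : StrictMonoOn (⇑x) (S : Set (Fin n))) (hz : StrictMonoOn (⇑z) (T : Set (Fin n))) :
    StrictMonoOn (⇑(x⁻¹ * z)) ((T.filter fun p => z p ∈ S.image ⇑x : Finset (Fin n)) : Set (Fin n)) := by
  classical
  intro p hp p' hp' hlt
  rw [Finset.coe_filter] at hp hp'
  obtain ⟨hpT, hpS⟩ := hp
  obtain ⟨hp'T, hp'S⟩ := hp'
  obtain ⟨i, hiS, hi⟩ := Finset.mem_image.mp hpS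
  obtain ⟨i', hi'S, hi'⟩ := Finset.mem_image.mp hp'S
  have hzlt : z p < z p' := hz hpT hp'T hlt
  show x⁻¹ (z p) < x⁻¹ (z p')
  rw [← hi, ← hi'] at hzlt ⊢
  rw [Equiv.Perm.inv_def, Equiv.symm_apply_apply, Equiv.symm_apply_apply]
  exact (hx.lt_iff_lt (Finset.mem_coe.mpr hiS) (Finset.mem_coe.mpr hi'S)).mp hzlt

/-- The position set of Lemma L is in bijection (via `z`) with the common letters `x(S) ∩ z(T)`. -/
theorem card_filter_mem_image {n : ℕ} (x z : Equiv.Perm (Fin n)) (S T : Finset (Fin n)) :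
    (T.filter fun p => z p ∈ S.image ⇑x).card = (S.image ⇑x ∩ T.image ⇑z).card := by
  classical
  refine Finset.card_bij (fun p _ => z p) ?_ ?_ ?_
  · intro p hp
    rw [Finset.mem_filter] at hp
    exact Finset.mem_inter.mpr ⟨hp.2, Finset.mem_image.mpr ⟨p, hp.1, rfl⟩⟩
  · intro p _ p' _ h
    exact z.injective h
  · intro b hb
    rw [Finset.mem_inter] at hb
    obtain ⟨p, hpT, rfl⟩ := Finset.mem_image.mp hb.2
    exact ⟨p, Finset.mem_filter.mpr ⟨hpT, hb.1⟩, rfl⟩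

/-- The common letters are at least `|S| + |T| - n` in number. -/
theorem card_add_card_sub_le_card_inter {n : ℕ} (x z : Equiv.Perm (Fin n)) (S T : Finset (Fin n)) :
    S.card + T.card - n ≤ (S.image ⇑x ∩ T.image ⇑z).card := by
  classical
  have h1 : (S.image ⇑x).card = S.card := Finset.card_image_of_injective S x.injective
  have h2 : (T.image ⇑z).card = T.card := Finset.card_image_of_injective T z.injective
  have h3 := Finset.card_inter_add_card_union (S.image ⇑x) (T.image ⇑z)
  have h4 : (S.image ⇑x ∪ T.image ⇑z).card ≤ n := by
    calc (S.image ⇑x ∪ T.image ⇑z).card ≤ (Finset.univ : Finset (Fin n)).card := Finset.card_le_univ _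
      _ = n := by simp
  omega

/-- The common letters counted through the displaced ones: `|x(S) ∩ z(T)| = n - |x(S)ᶜ ∪ z(T)ᶜ|`. -/
theorem card_inter_eq_sub_card_compl_union {n : ℕ} (x z : Equiv.Perm (Fin n)) (S T : Finset (Fin n)) :
    (S.image ⇑x ∩ T.image ⇑z).card = n - ((S.image ⇑x)ᶜ ∪ (T.image ⇑z)ᶜ).card := by
  classical
  have h := Finset.card_compl ((S.image ⇑x)ᶜ ∪ (T.image ⇑z)ᶜ)
  rw [Fintype.card_fin, Finset.compl_union, compl_compl, compl_compl] at h
  exact h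

/-- **Letters erase additively** (shell form of Lemma L): `x⁻¹ * z` has an increasing subsequence of length
`|x(S) ∩ z(T)|`. -/
theorem exists_incSubseq_inv_mul {n : ℕ} (x z : Equiv.Perm (Fin n)) (S T : Finset (Fin n))
    (hx : StrictMonoOn (⇑x) (S : Set (Fin n))) (hz : StrictMonoOn (⇑z) (T : Set (Fin n))) :
    ∃ s : Finset (Fin n), (S.image ⇑x ∩ T.image ⇑z).card ≤ s.card ∧
      StrictMonoOn (⇑(x⁻¹ * z)) (s : Set (Fin n)) := by
  classical
  exact ⟨_, (card_filter_mem_image x z S T).ge, strictMonoOn_inv_mul x z hx hz⟩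

/-- Same, with the bound written through the DISPLACED letter sets `U = x(S)ᶜ` (of `x`) and `L = z(T)ᶜ` (of `z`):
`x⁻¹ * z ∈ B_{|U ∪ L|} = B_{|U| + |L| - |U ∩ L|}` — every shared displaced letter lowers the level by one. -/
theorem exists_incSubseq_inv_mul_compl {n : ℕ} (x z : Equiv.Perm (Fin n)) (S T : Finset (Fin n))
    (hx : StrictMonoOn (⇑x) (S : Set (Fin n))) (hz : StrictMonoOn (⇑z) (T : Set (Fin n))) :
    ∃ s : Finset (Fin n), n - ((S.image ⇑x)ᶜ ∪ (T.image ⇑z)ᶜ).card ≤ s.card ∧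
      StrictMonoOn (⇑(x⁻¹ * z)) (s : Set (Fin n)) := by
  classical
  rw [← card_inter_eq_sub_card_compl_union]
  exact exists_incSubseq_inv_mul x z S T hx hz

open Classical in
/-- **Collision ladder, counting form (★).** Let `S x` (`x ∈ X`) and `T z` (`z ∈ Z`) be increasing position sets and
suppose `(x, z) ↦ x⁻¹ * z` is injective on `X ×ˢ Z`. Then for every `j`, the pairs whose displaced-letter sets
`x(S x)ᶜ`, `z(T z)ᶜ` have a union of size `≤ j` — e.g. `|x(S x)ᶜ| = a`, `|z(T z)ᶜ| = b` with `≥ a + b - j` SHARED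
letters — number at most `|B_j|`, `B_j = {g | ∃ s, n - j ≤ |s| ∧ g increasing on s}` (the crux's Schensted shell). -/
theorem card_filter_shared_le {n : ℕ} (X Z : Finset (Equiv.Perm (Fin n)))
    (S T : Equiv.Perm (Fin n) → Finset (Fin n))
    (hS : ∀ x ∈ X, StrictMonoOn (⇑x) (S x : Set (Fin n)))
    (hT : ∀ z ∈ Z, StrictMonoOn (⇑z) (T z : Set (Fin n)))
    (hinj : Set.InjOn (fun xz : Equiv.Perm (Fin n) × Equiv.Perm (Fin n) => xz.1⁻¹ * xz.2)
      ((X ×ˢ Z : Finset _) : Set _)) (j : ℕ) :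
    ((X ×ˢ Z).filter fun xz : Equiv.Perm (Fin n) × Equiv.Perm (Fin n) =>
        (((S xz.1).image ⇑(xz.1))ᶜ ∪ ((T xz.2).image ⇑(xz.2))ᶜ).card ≤ j).card ≤
      (Finset.univ.filter fun g : Equiv.Perm (Fin n) =>
        ∃ s : Finset (Fin n), n - j ≤ s.card ∧ StrictMonoOn (⇑g) (s : Set (Fin n))).card := by
  refine Finset.card_le_card_of_injOn (fun xz => xz.1⁻¹ * xz.2) ?_ ?_
  · intro xz hxz
    rw [Finset.coe_filter] at hxz
    obtain ⟨hmem, hj⟩ := hxz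
    obtain ⟨hxX, hzZ⟩ := Finset.mem_product.mp hmem
    obtain ⟨s, hs, hmono⟩ := exists_incSubseq_inv_mul_compl xz.1 xz.2 (S xz.1) (T xz.2) (hS _ hxX) (hT _ hzZ)
    simp only [Finset.coe_filter, Finset.mem_univ, true_and, Set.mem_setOf_eq]
    exact ⟨s, le_trans (by omega) hs, hmono⟩
  · intro a ha b hb hab
    rw [Finset.coe_filter] at ha hb
    exact hinj ha.1 hb.1 hab

end Summit.MatrixMultiplication.MatrixMultiplication.Theorems.SnLevelDesigns.Negative
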